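import Mathlib
import Summits.AtomisticToContinuum.Crystallization.Theorems.NashClassCertificatesNashNearFieldStubCauchyBornBarlowCoercivityWordFree

/-!
# Crux `NashNearField` (stmt-AtomisticToContinuum-16827), line `birth`, stub `stub_layerLandscapeTenth` (LL⅒):
# certificate design — the triangular (QR) gauge, the near/far split, `LL⅒` from NEAR and FAR

`LL⅒` (skeleton v7): `∃ κ > 0`, for every `G` in the `4/5–6/5` tube a box cell `(A, a, h)` with
`κ·min(dist(G p, A p_{a,h}), 1/10)² ≤ W(G; a, h)` at every unit-template layer vector `p` of norm `≤ 3`, `W` the word-free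
layer landscape excess.  CERTIFICATE DESIGN.  (1) Gauge: `G = A·T` with `A` a linear isometry and `T` upper triangular with
positive diagonal (Gram–Schmidt, §2 below); `W(G) = W(T)` (only `‖G v‖ = ‖T v‖` enters) and, choosing THIS
`A`, `dist(G p, A p_{a,h}) = ‖T p − diag(a, a, h/h₀) p‖`.  So LL⅒ follows from `TRI⅒` — the same inequality for the six real
parameters `t = (t₀₀, t₀₁, t₀₂, t₁₁, t₁₂, t₂₂)` of `T`, written out in coordinates (the unit-template layer vector
`layerVec 1 h₀ δ k i j` has coordinates `X = i + j/2 + δ/2`, `Y = (√3/2)(j + δ/3)`, `Z = k h₀`; the tube is the polynomial condition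
`(4/5)²|v|² ≤ |T v|² ≤ (6/5)²|v|²`).  (2) Selection: `(a, h) := π(t)`, the clip of `((t₀₀ + t₁₁)/2, h₀ t₂₂)` to the box —
continuous, the identity on the box family, `A := id` in the gauge.  (3) Split by the squared Frobenius distance
`S² = (t₀₀ − a)² + (t₁₁ − a)² + (t₂₂ − h/h₀)² + t₀₁² + t₀₂² + t₁₂²` of `T` to the selected cell: since `|T p − D p| ≤ S·|p| ≤ 3 S`,
  * NEAR (`S² ≤ 1/100`): `c·S² ≤ W(T; π(t))` — local quadratic growth off the family (the family is TRANSVERSALLY CRITICAL for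
    every layer excess by the `C₃` symmetry, the transverse `½`-Hessian is positive definite on the whole box, numerically `≥ 0.43`
    in `W/S²`; outward of the box the clipped excess grows linearly, `W/S ≥ 0.39`), to be certified by a second-order Taylor bound
    at the family with an interval Hessian over the `1/10`-neighbourhood plus a third-order remainder;
  * FAR (`1/100 ≤ S²`): `w₀ ≤ W(T; π(t))` — a positive floor on a compact semialgebraic `6`-parameter set (numerically
    `min W ≈ 0.0045` on the shell `S = 1/10`, `≥ 0.0127` from `S ≥ 0.14` on `500` tube samples), to be certified by branch and
    bound with first/second-order centred forms;
  give `TRI⅒` with `κ = min(c/9, 100 w₀)` (`stub_triLandscapeTenth_of_near_far`, proved here: bookkeeping only).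
The remaining sorries of the line below LL⅒ are therefore the two interval-arithmetic claims `stub_triLandscapeNear` /
`stub_triLandscapeFar` (registered; their exact texts are the two hypotheses of `stub_triLandscapeTenth_of_near_far`).

## The gauge is complete (`TRI⅒ → LL⅒`)
For `G` in the `4/5–6/5` tube let `f_j = G e_j`, `b` the Gram–Schmidt orthonormal basis of `(f₀, f₁, f₂)` and `A : e_j ↦ b_j` (a
linear isometry).  Then `T := A⁻¹ ∘ G` is upper triangular with positive diagonal (`t_{lj} = ⟪b_l, f_j⟫`, `t_{jj} = ‖gs_j‖ > 0`),
`‖G v‖ = ‖T v‖` (so `T` is in the tube and the word-free excess `W(G; a, h)` IS `W(T; a, h)`), and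
`dist(G p, A q) = ‖T p − q‖`.  Hence the triangular-gauge inequality `TRI⅒` (six real parameters, polynomial tube,
explicit coordinates) implies `LL⅒` with the same `κ`, choosing THIS `A` and the cell `(a, h)` that `TRI⅒`
provides: `stub_layerLandscapeTenth_of_tri` (proved).  With `stub_triLandscapeTenth_of_near_far` the open content of LL⅒ — hence
of CBBC — is exactly the pair NEAR/FAR of interval-arithmetic claims.
-/

noncomputable section

open scoped BigOperators InnerProductSpace
open Module InnerProductSpace
open Literature.MathematicalPhysics.StatisticalMechanics Literature.Geometry.DiscreteGeometry

namespace Summit.AtomisticToContinuum.Crystallization.Theorems.NashClassCertificatesNashNearField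

/-- Cauchy–Schwarz for three terms (Lagrange's identity). [folklore] -/
theorem tri_cs3 (α β γ x y z : ℝ) :
    (α * x + β * y + γ * z) ^ 2 ≤ (α ^ 2 + β ^ 2 + γ ^ 2) * (x ^ 2 + y ^ 2 + z ^ 2) := by
  nlinarith [sq_nonneg (α * y - β * x), sq_nonneg (α * z - γ * x), sq_nonneg (β * z - γ * y)]

/-- The squared norm of the unit-template layer vector in coordinates:
`‖layerVec 1 h₀ δ k i j‖² = X² + Y² + Z²`, `X = i + j/2 + δ/2`, `Y = (√3/2)(j + δ/3)`, `Z = k h₀`. [folklore] -/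
theorem tri_norm_layerVec_sq (δ k i j : ℤ) :
    ‖layerVec 1 (Real.sqrt 6 / 3) δ k i j‖ ^ 2 =
      ((i : ℝ) + (j : ℝ) / 2 + (δ : ℝ) / 2) ^ 2 + (Real.sqrt 3 / 2 * ((j : ℝ) + (δ : ℝ) / 3)) ^ 2 + ((k : ℝ) * (Real.sqrt 6 / 3)) ^ 2 := by
  rw [norm_layerVec, Real.sq_sqrt (by positivity)]
  ring

/-- **The penalty in the triangular gauge is controlled by the Frobenius distance to the cell**:
`((t₀₀−a)X + t₀₁Y + t₀₂Z)² + ((t₁₁−a)Y + t₁₂Z)² + ((t₂₂−h/h₀)Z)² ≤ S²·(X² + Y² + Z²)`. [folklore] -/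
theorem tri_penalty_sq_le (t₀₀ t₀₁ t₀₂ t₁₁ t₁₂ t₂₂ a h X' Y' Z' : ℝ) :
    ((t₀₀ - a) * X' + t₀₁ * Y' + t₀₂ * Z') ^ 2 + ((t₁₁ - a) * Y' + t₁₂ * Z') ^ 2 +
        ((t₂₂ - h / (Real.sqrt 6 / 3)) * Z') ^ 2 ≤
      ((t₀₀ - a) ^ 2 + (t₁₁ - a) ^ 2 + (t₂₂ - h / (Real.sqrt 6 / 3)) ^ 2 + t₀₁ ^ 2 + t₀₂ ^ 2 + t₁₂ ^ 2) * (X' ^ 2 + Y' ^ 2 + Z' ^ 2) := by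
  have h1 := tri_cs3 (t₀₀ - a) t₀₁ t₀₂ X' Y' Z'
  have h2 : ((t₁₁ - a) * Y' + t₁₂ * Z') ^ 2 ≤ ((t₁₁ - a) ^ 2 + t₁₂ ^ 2) * (X' ^ 2 + Y' ^ 2 + Z' ^ 2) := by
    nlinarith [sq_nonneg ((t₁₁ - a) * Z' - t₁₂ * Y'), sq_nonneg X', sq_nonneg (t₁₁ - a), sq_nonneg t₁₂,
      mul_nonneg (add_nonneg (sq_nonneg (t₁₁ - a)) (sq_nonneg t₁₂)) (sq_nonneg X')]
  have h3 : ((t₂₂ - h / (Real.sqrt 6 / 3)) * Z') ^ 2 ≤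
      (t₂₂ - h / (Real.sqrt 6 / 3)) ^ 2 * (X' ^ 2 + Y' ^ 2 + Z' ^ 2) := by
    nlinarith [sq_nonneg (t₂₂ - h / (Real.sqrt 6 / 3)), sq_nonneg X', sq_nonneg Y',
      mul_nonneg (sq_nonneg (t₂₂ - h / (Real.sqrt 6 / 3))) (add_nonneg (sq_nonneg X') (sq_nonneg Y'))]
  nlinarith [h1, h2, h3]

/-- The box selection `π(t)` lands in the box. [folklore] -/
theorem tri_pi_mem_box (t₀₀ t₁₁ t₂₂ a h : ℝ) (ha : a = max (47 / 50) (min 1 ((t₀₀ + t₁₁) / 2))) (hh : h = max (39 / 50 * a) (min (17 / 20 * a) (Real.sqrt 6 / 3 * t₂₂))) :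
    47 / 50 ≤ a ∧ a ≤ 1 ∧ 39 / 50 * a ≤ h ∧ h ≤ 17 / 20 * a := by
  have ha1 : 47 / 50 ≤ a := by rw [ha]; exact le_max_left _ _
  have ha2 : a ≤ 1 := by
    rw [ha]
    exact max_le (by norm_num) (min_le_left _ _)
  refine ⟨ha1, ha2, ?_, ?_⟩
  · rw [hh]; exact le_max_left _ _
  · rw [hh]
    exact max_le (by linarith) (min_le_left _ _)

/-- The scalar bookkeeping of the near/far split. [folklore] -/
theorem tri_bookkeeping {c w₀ S2 P2 B W : ℝ} (hc : 0 < c) (hw : 0 < w₀) (hP0 : 0 ≤ P2) (hB : B ≤ 9)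
    (hpen : P2 ≤ S2 * B) (hS0 : 0 ≤ S2) (hN : S2 ≤ 1 / 100 → c * S2 ≤ W) (hF : 1 / 100 ≤ S2 → w₀ ≤ W) :
    min (c / 9) (100 * w₀) * (min (Real.sqrt P2) (1 / 10)) ^ 2 ≤ W := by
  have hκ1 : min (c / 9) (100 * w₀) ≤ c / 9 := min_le_left _ _
  have hκ2 : min (c / 9) (100 * w₀) ≤ 100 * w₀ := min_le_right _ _
  have hpen' : P2 ≤ S2 * 9 := hpen.trans (mul_le_mul_of_nonneg_left hB hS0)
  have hm0 : 0 ≤ min (Real.sqrt P2) (1 / 10) := le_min (Real.sqrt_nonneg _) (by norm_num)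
  have hmP : (min (Real.sqrt P2) (1 / 10)) ^ 2 ≤ P2 := by
    calc (min (Real.sqrt P2) (1 / 10)) ^ 2 ≤ (Real.sqrt P2) ^ 2 := pow_le_pow_left₀ hm0 (min_le_left _ _) 2
      _ = P2 := Real.sq_sqrt hP0
  have hm1 : (min (Real.sqrt P2) (1 / 10)) ^ 2 ≤ 1 / 100 := by
    calc (min (Real.sqrt P2) (1 / 10)) ^ 2 ≤ (1 / 10) ^ 2 := pow_le_pow_left₀ hm0 (min_le_right _ _) 2
      _ = 1 / 100 := by norm_num
  by_cases hS : S2 ≤ 1 / 100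
  · calc min (c / 9) (100 * w₀) * (min (Real.sqrt P2) (1 / 10)) ^ 2 ≤ (c / 9) * P2 :=
          mul_le_mul hκ1 hmP (sq_nonneg _) (by positivity)
      _ ≤ c * S2 := by nlinarith [hpen', hc]
      _ ≤ W := hN hS
  · calc min (c / 9) (100 * w₀) * (min (Real.sqrt P2) (1 / 10)) ^ 2 ≤ (100 * w₀) * (1 / 100) :=
          mul_le_mul hκ2 hm1 (sq_nonneg _) (by positivity)
      _ = w₀ := by ring
      _ ≤ W := hF (not_le.1 hS).le

/-- **`TRI⅒` from NEAR and FAR (stub piece `stub_triLandscapeTenth_of_near_far`, proved; bookkeeping only).**  In the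
triangular gauge with the clipped cell selection `π(t)`: if `c·S² ≤ W` whenever `S² ≤ 1/100` (NEAR) and `w₀ ≤ W` whenever
`1/100 ≤ S²` (FAR), then `κ·min(|T p − D_{π(t)} p|, 1/10)² ≤ W` at every unit-template layer vector of norm `≤ 3`, with
`κ = min(c/9, 100 w₀)` — because `|T p − D p|² ≤ S²|p|² ≤ 9 S²` and `min(·, 1/10)² ≤ 1/100`. [folklore] -/
theorem stub_triLandscapeTenth_of_near_far :
    (∃ c : ℝ, 0 < c ∧ ∀ t₀₀ t₀₁ t₀₂ t₁₁ t₁₂ t₂₂ a h : ℝ, 0 < t₀₀ → 0 < t₁₁ → 0 < t₂₂ →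
        (∀ x y z : ℝ, (4 / 5 : ℝ) ^ 2 * (x ^ 2 + y ^ 2 + z ^ 2) ≤
          (t₀₀ * x + t₀₁ * y + t₀₂ * z) ^ 2 + (t₁₁ * y + t₁₂ * z) ^ 2 + (t₂₂ * z) ^ 2 ∧
        (t₀₀ * x + t₀₁ * y + t₀₂ * z) ^ 2 + (t₁₁ * y + t₁₂ * z) ^ 2 + (t₂₂ * z) ^ 2 ≤
          (6 / 5 : ℝ) ^ 2 * (x ^ 2 + y ^ 2 + z ^ 2)) →
        a = max (47 / 50) (min 1 ((t₀₀ + t₁₁) / 2)) →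
        h = max (39 / 50 * a) (min (17 / 20 * a) (Real.sqrt 6 / 3 * t₂₂)) →
        ((t₀₀ - a) ^ 2 + (t₁₁ - a) ^ 2 + (t₂₂ - h / (Real.sqrt 6 / 3)) ^ 2 + t₀₁ ^ 2 + t₀₂ ^ 2 + t₁₂ ^ 2) ≤ 1 / 100 →
        c * ((t₀₀ - a) ^ 2 + (t₁₁ - a) ^ 2 + (t₂₂ - h / (Real.sqrt 6 / 3)) ^ 2 + t₀₁ ^ 2 + t₀₂ ^ 2 + t₁₂ ^ 2) ≤
        (fun Δ : ℤ → ℤ → ℝ => (1 / 2 : ℝ) * (Δ 0 0 +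
            (∑' k : ℕ, if k = 0 then min (Δ 1 1) (Δ (-1) 1)
              else min (Δ 0 ((k : ℤ) + 1)) (min (Δ 1 ((k : ℤ) + 1)) (Δ (-1) ((k : ℤ) + 1)))) +
            (∑' k : ℕ, if k = 0 then min (Δ 1 (-1)) (Δ (-1) (-1))
              else min (Δ 0 (-((k : ℤ) + 1))) (min (Δ 1 (-((k : ℤ) + 1))) (Δ (-1) (-((k : ℤ) + 1)))))))
          (fun δ s => (∑' ij : ℤ × ℤ, lennardJones (Real.sqrt ((t₀₀ * ((ij.1 : ℝ) + (ij.2 : ℝ) / 2 + (δ : ℝ) / 2) + t₀₁ * (Real.sqrt 3 / 2 * ((ij.2 : ℝ) + (δ : ℝ) / 3)) + t₀₂ * ((s : ℝ) * (Real.sqrt 6 / 3))) ^ 2 + (t₁₁ * (Real.sqrt 3 / 2 * ((ij.2 : ℝ) + (δ : ℝ) / 3)) + t₁₂ * ((s : ℝ) * (Real.sqrt 6 / 3))) ^ 2 + (t₂₂ * ((s : ℝ) * (Real.sqrt 6 / 3))) ^ 2))) -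
            layerInteraction lennardJones a h δ s)) →
    (∃ w₀ : ℝ, 0 < w₀ ∧ ∀ t₀₀ t₀₁ t₀₂ t₁₁ t₁₂ t₂₂ a h : ℝ, 0 < t₀₀ → 0 < t₁₁ → 0 < t₂₂ →
        (∀ x y z : ℝ, (4 / 5 : ℝ) ^ 2 * (x ^ 2 + y ^ 2 + z ^ 2) ≤
          (t₀₀ * x + t₀₁ * y + t₀₂ * z) ^ 2 + (t₁₁ * y + t₁₂ * z) ^ 2 + (t₂₂ * z) ^ 2 ∧
        (t₀₀ * x + t₀₁ * y + t₀₂ * z) ^ 2 + (t₁₁ * y + t₁₂ * z) ^ 2 + (t₂₂ * z) ^ 2 ≤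
          (6 / 5 : ℝ) ^ 2 * (x ^ 2 + y ^ 2 + z ^ 2)) →
        a = max (47 / 50) (min 1 ((t₀₀ + t₁₁) / 2)) →
        h = max (39 / 50 * a) (min (17 / 20 * a) (Real.sqrt 6 / 3 * t₂₂)) →
        1 / 100 ≤ ((t₀₀ - a) ^ 2 + (t₁₁ - a) ^ 2 + (t₂₂ - h / (Real.sqrt 6 / 3)) ^ 2 + t₀₁ ^ 2 + t₀₂ ^ 2 + t₁₂ ^ 2) →
        w₀ ≤
        (fun Δ : ℤ → ℤ → ℝ => (1 / 2 : ℝ) * (Δ 0 0 +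
            (∑' k : ℕ, if k = 0 then min (Δ 1 1) (Δ (-1) 1)
              else min (Δ 0 ((k : ℤ) + 1)) (min (Δ 1 ((k : ℤ) + 1)) (Δ (-1) ((k : ℤ) + 1)))) +
            (∑' k : ℕ, if k = 0 then min (Δ 1 (-1)) (Δ (-1) (-1))
              else min (Δ 0 (-((k : ℤ) + 1))) (min (Δ 1 (-((k : ℤ) + 1))) (Δ (-1) (-((k : ℤ) + 1)))))))
          (fun δ s => (∑' ij : ℤ × ℤ, lennardJones (Real.sqrt ((t₀₀ * ((ij.1 : ℝ) + (ij.2 : ℝ) / 2 + (δ : ℝ) / 2) + t₀₁ * (Real.sqrt 3 / 2 * ((ij.2 : ℝ) + (δ : ℝ) / 3)) + t₀₂ * ((s : ℝ) * (Real.sqrt 6 / 3))) ^ 2 + (t₁₁ * (Real.sqrt 3 / 2 * ((ij.2 : ℝ) + (δ : ℝ) / 3)) + t₁₂ * ((s : ℝ) * (Real.sqrt 6 / 3))) ^ 2 + (t₂₂ * ((s : ℝ) * (Real.sqrt 6 / 3))) ^ 2))) -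
            layerInteraction lennardJones a h δ s)) →
    ∃ κ : ℝ, 0 < κ ∧ ∀ t₀₀ t₀₁ t₀₂ t₁₁ t₁₂ t₂₂ : ℝ, 0 < t₀₀ → 0 < t₁₁ → 0 < t₂₂ →
        (∀ x y z : ℝ, (4 / 5 : ℝ) ^ 2 * (x ^ 2 + y ^ 2 + z ^ 2) ≤
          (t₀₀ * x + t₀₁ * y + t₀₂ * z) ^ 2 + (t₁₁ * y + t₁₂ * z) ^ 2 + (t₂₂ * z) ^ 2 ∧
        (t₀₀ * x + t₀₁ * y + t₀₂ * z) ^ 2 + (t₁₁ * y + t₁₂ * z) ^ 2 + (t₂₂ * z) ^ 2 ≤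
          (6 / 5 : ℝ) ^ 2 * (x ^ 2 + y ^ 2 + z ^ 2)) →
        ∃ a h : ℝ, 47 / 50 ≤ a ∧ a ≤ 1 ∧ 39 / 50 * a ≤ h ∧ h ≤ 17 / 20 * a ∧
          ∀ δ k i j : ℤ, ‖layerVec 1 (Real.sqrt 6 / 3) δ k i j‖ ≤ 3 →
            κ * (min (Real.sqrt (((t₀₀ - a) * ((i : ℝ) + (j : ℝ) / 2 + (δ : ℝ) / 2) + t₀₁ * (Real.sqrt 3 / 2 * ((j : ℝ) + (δ : ℝ) / 3)) + t₀₂ * ((k : ℝ) * (Real.sqrt 6 / 3))) ^ 2 + ((t₁₁ - a) * (Real.sqrt 3 / 2 * ((j : ℝ) + (δ : ℝ) / 3)) + t₁₂ * ((k : ℝ) * (Real.sqrt 6 / 3))) ^ 2 + ((t₂₂ - h / (Real.sqrt 6 / 3)) * ((k : ℝ) * (Real.sqrt 6 / 3))) ^ 2)) (1 / 10)) ^ 2 ≤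
            (fun Δ : ℤ → ℤ → ℝ => (1 / 2 : ℝ) * (Δ 0 0 +
              (∑' k : ℕ, if k = 0 then min (Δ 1 1) (Δ (-1) 1)
                else min (Δ 0 ((k : ℤ) + 1)) (min (Δ 1 ((k : ℤ) + 1)) (Δ (-1) ((k : ℤ) + 1)))) +
              (∑' k : ℕ, if k = 0 then min (Δ 1 (-1)) (Δ (-1) (-1))
                else min (Δ 0 (-((k : ℤ) + 1))) (min (Δ 1 (-((k : ℤ) + 1))) (Δ (-1) (-((k : ℤ) + 1)))))))
            (fun δ s => (∑' ij : ℤ × ℤ, lennardJones (Real.sqrt ((t₀₀ * ((ij.1 : ℝ) + (ij.2 : ℝ) / 2 + (δ : ℝ) / 2) + t₀₁ * (Real.sqrt 3 / 2 * ((ij.2 : ℝ) + (δ : ℝ) / 3)) + t₀₂ * ((s : ℝ) * (Real.sqrt 6 / 3))) ^ 2 + (t₁₁ * (Real.sqrt 3 / 2 * ((ij.2 : ℝ) + (δ : ℝ) / 3)) + t₁₂ * ((s : ℝ) * (Real.sqrt 6 / 3))) ^ 2 + (t₂₂ * ((s : ℝ) * (Real.sqrt 6 / 3))) ^ 2)))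 -
              layerInteraction lennardJones a h δ s) := by
  rintro ⟨c, hc, hN⟩ ⟨w₀, hw₀, hF⟩
  refine ⟨min (c / 9) (100 * w₀), lt_min (by positivity) (by positivity), ?_⟩
  intro t₀₀ t₀₁ t₀₂ t₁₁ t₁₂ t₂₂ h00 h11 h22 htube
  obtain ⟨a, ha⟩ : ∃ a : ℝ, a = max (47 / 50) (min 1 ((t₀₀ + t₁₁) / 2)) := ⟨_, rfl⟩
  obtain ⟨h, hh⟩ : ∃ h : ℝ, h = max (39 / 50 * a) (min (17 / 20 * a) (Real.sqrt 6 / 3 * t₂₂)) := ⟨_, rfl⟩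
  obtain ⟨ha1, ha2, hh1, hh2⟩ := tri_pi_mem_box t₀₀ t₁₁ t₂₂ a h ha hh
  refine ⟨a, h, ha1, ha2, hh1, hh2, fun δ k i j hn => ?_⟩
  have hB : ((i : ℝ) + (j : ℝ) / 2 + (δ : ℝ) / 2) ^ 2 + (Real.sqrt 3 / 2 * ((j : ℝ) + (δ : ℝ) / 3)) ^ 2 + ((k : ℝ) * (Real.sqrt 6 / 3)) ^ 2 ≤ 9 := by
    rw [← tri_norm_layerVec_sq]
    nlinarith [norm_nonneg (layerVec 1 (Real.sqrt 6 / 3) δ k i j)]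
  exact tri_bookkeeping hc hw₀ (by positivity) hB (tri_penalty_sq_le t₀₀ t₀₁ t₀₂ t₁₁ t₁₂ t₂₂ a h _ _ _)
    (by positivity) (hN t₀₀ t₀₁ t₀₂ t₁₁ t₁₂ t₂₂ a h h00 h11 h22 htube ha hh)
    (hF t₀₀ t₀₁ t₀₂ t₁₁ t₁₂ t₂₂ a h h00 h11 h22 htube ha hh)


/-- `finrank ℝ ℝ³ = 3`. [folklore] -/
theorem qr_finrank : finrank ℝ (EuclideanSpace ℝ (Fin 3)) = Fintype.card (Fin 3) := finrank_euclideanSpace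

/-- `⟪gs i, f i⟫ = ‖gs i‖²` for the Gram–Schmidt process. [folklore] -/
theorem qr_inner_gramSchmidt_self (f : Fin 3 → EuclideanSpace ℝ (Fin 3)) (i : Fin 3) :
    ⟪gramSchmidt ℝ f i, f i⟫_ℝ = ‖gramSchmidt ℝ f i‖ ^ 2 := by
  conv_lhs => rw [gramSchmidt_def'' ℝ f i]
  rw [inner_add_right, real_inner_self_eq_norm_sq, inner_sum, add_eq_left]
  refine Finset.sum_eq_zero fun k hk => ?_
  rw [real_inner_smul_right, gramSchmidt_orthogonal ℝ f (Finset.mem_Iio.1 hk).ne', mul_zero]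

/-- **The diagonal of the QR factor is positive**: `⟪b i, f i⟫ = ‖gs i‖ > 0` for a linearly independent triple. [folklore] -/
theorem qr_diag_pos (f : Fin 3 → EuclideanSpace ℝ (Fin 3)) (hf : LinearIndependent ℝ f) (i : Fin 3) :
    0 < (gramSchmidtOrthonormalBasis qr_finrank f).repr (f i) i := by
  have hne : gramSchmidt ℝ f i ≠ 0 := gramSchmidt_ne_zero i hf
  have hnpos : 0 < ‖gramSchmidt ℝ f i‖ := norm_pos_iff.2 hne
  have hN : gramSchmidtNormed ℝ f i ≠ 0 := by
    rw [gramSchmidtNormed]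
    exact smul_ne_zero (inv_ne_zero hnpos.ne') hne
  rw [OrthonormalBasis.repr_apply_apply, gramSchmidtOrthonormalBasis_apply qr_finrank hN, gramSchmidtNormed,
    real_inner_smul_left, qr_inner_gramSchmidt_self]
  have : ‖gramSchmidt ℝ f i‖⁻¹ * ‖gramSchmidt ℝ f i‖ ^ 2 = ‖gramSchmidt ℝ f i‖ := by
    field_simp
  simp only [RCLike.ofReal_real_eq_id, id_eq]
  rw [this]
  exact hnpos

/-- **The QR factor is upper triangular**: `⟪b j, f i⟫ = 0` for `i < j`. [folklore] -/
theorem qr_upper (f : Fin 3 → EuclideanSpace ℝ (Fin 3)) {i j : Fin 3} (hij : i < j) :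
    (gramSchmidtOrthonormalBasis qr_finrank f).repr (f i) j = 0 :=
  gramSchmidtOrthonormalBasis_inv_triangular' qr_finrank f hij

/-- **Coordinates in the Gram–Schmidt frame**: `(A⁻¹ (G v))_l = ∑_j v_j ⟪b_l, f_j⟫`. [folklore] -/
theorem qr_coord (G : EuclideanSpace ℝ (Fin 3) ≃L[ℝ] EuclideanSpace ℝ (Fin 3)) (v : EuclideanSpace ℝ (Fin 3)) (l : Fin 3) :
    (((EuclideanSpace.basisFun (Fin 3) ℝ).equiv
        (gramSchmidtOrthonormalBasis qr_finrank fun j => G (EuclideanSpace.single j 1)) (Equiv.refl _)).symm (G v)) l =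
      ∑ j : Fin 3, v j * (gramSchmidtOrthonormalBasis qr_finrank fun j => G (EuclideanSpace.single j 1)).repr
        (G (EuclideanSpace.single j 1)) l := by
  have hv : G v = ∑ j : Fin 3, v j • G (EuclideanSpace.single j 1) := by
    have := (EuclideanSpace.basisFun (Fin 3) ℝ).sum_repr v
    conv_lhs => rw [← this]
    simp [map_sum, map_smul, EuclideanSpace.basisFun_apply]
  rw [hv, map_sum]
  simp only [map_smul, OrthonormalBasis.equiv_symm, Equiv.refl_symm, OrthonormalBasis.equiv_apply,
    Equiv.refl_apply, EuclideanSpace.basisFun_apply]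
  simp [Finset.sum_apply, Pi.smul_apply, Pi.single_apply, Finset.sum_ite_eq]

/-- The images of the standard basis under an automorphism are linearly independent. [folklore] -/
theorem qr_linearIndependent (G : EuclideanSpace ℝ (Fin 3) ≃L[ℝ] EuclideanSpace ℝ (Fin 3)) :
    LinearIndependent ℝ fun j : Fin 3 => G (EuclideanSpace.single j (1 : ℝ)) := by
  have h := (EuclideanSpace.basisFun (Fin 3) ℝ).toBasis.linearIndependent.map' G.toLinearEquiv.toLinearMap
    G.toLinearEquiv.ker
  convert h using 1 <;> first | rfl | (ext j; simp [EuclideanSpace.basisFun_apply])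

/-- **`TRI⅒ → LL⅒` (stub piece `stub_layerLandscapeTenth_of_tri`, proved): the triangular gauge is complete.**  Given `G` in
the tube, Gram–Schmidt on `(G e₀, G e₁, G e₂)` yields a linear isometry `A` with `A⁻¹ ∘ G` upper triangular with positive
diagonal `t`; `t` inherits the (polynomial) tube condition, `TRI⅒` supplies the cell `(a, h)` and the inequality, and
`dist(G p, A p_{a,h}) = ‖T p − D p‖`, `‖G v‖ = ‖T v‖` turn it into the `LL⅒` inequality for `(A, a, h)`. [folklore] -/
theorem stub_layerLandscapeTenth_of_tri :
    (∃ κ : ℝ, 0 < κ ∧ ∀ t₀₀ t₀₁ t₀₂ t₁₁ t₁₂ t₂₂ : ℝ, 0 < t₀₀ → 0 < t₁₁ → 0 < t₂₂ →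
        (∀ x y z : ℝ, (4 / 5 : ℝ) ^ 2 * (x ^ 2 + y ^ 2 + z ^ 2) ≤
          (t₀₀ * x + t₀₁ * y + t₀₂ * z) ^ 2 + (t₁₁ * y + t₁₂ * z) ^ 2 + (t₂₂ * z) ^ 2 ∧
        (t₀₀ * x + t₀₁ * y + t₀₂ * z) ^ 2 + (t₁₁ * y + t₁₂ * z) ^ 2 + (t₂₂ * z) ^ 2 ≤
          (6 / 5 : ℝ) ^ 2 * (x ^ 2 + y ^ 2 + z ^ 2)) →
        ∃ a h : ℝ, 47 / 50 ≤ a ∧ a ≤ 1 ∧ 39 / 50 * a ≤ h ∧ h ≤ 17 / 20 * a ∧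
          ∀ δ k i j : ℤ, ‖layerVec 1 (Real.sqrt 6 / 3) δ k i j‖ ≤ 3 →
            κ * (min (Real.sqrt (((t₀₀ - a) * ((i : ℝ) + (j : ℝ) / 2 + (δ : ℝ) / 2) + t₀₁ * (Real.sqrt 3 / 2 * ((j : ℝ) + (δ : ℝ) / 3)) + t₀₂ * ((k : ℝ) * (Real.sqrt 6 / 3))) ^ 2 + ((t₁₁ - a) * (Real.sqrt 3 / 2 * ((j : ℝ) + (δ : ℝ) / 3)) + t₁₂ * ((k : ℝ) * (Real.sqrt 6 / 3))) ^ 2 + ((t₂₂ - h / (Real.sqrt 6 / 3)) * ((k : ℝ) * (Real.sqrt 6 / 3))) ^ 2)) (1 / 10)) ^ 2 ≤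
            (fun Δ : ℤ → ℤ → ℝ => (1 / 2 : ℝ) * (Δ 0 0 +
              (∑' k : ℕ, if k = 0 then min (Δ 1 1) (Δ (-1) 1)
                else min (Δ 0 ((k : ℤ) + 1)) (min (Δ 1 ((k : ℤ) + 1)) (Δ (-1) ((k : ℤ) + 1)))) +
              (∑' k : ℕ, if k = 0 then min (Δ 1 (-1)) (Δ (-1) (-1))
                else min (Δ 0 (-((k : ℤ) + 1))) (min (Δ 1 (-((k : ℤ) + 1))) (Δ (-1) (-((k : ℤ) + 1)))))))
            (fun δ s => (∑' ij : ℤ × ℤ, lennardJones (Real.sqrt ((t₀₀ * ((ij.1 : ℝ) + (ij.2 : ℝ) / 2 + (δ : ℝ) / 2) + t₀₁ * (Real.sqrt 3 / 2 * ((ij.2 : ℝ) + (δ : ℝ) / 3)) + t₀₂ * ((s : ℝ) * (Real.sqrt 6 / 3))) ^ 2 + (t₁₁ * (Real.sqrt 3 / 2 * ((ij.2 : ℝ) + (δ : ℝ) / 3)) + t₁₂ * ((s : ℝ) * (Real.sqrt 6 / 3))) ^ 2 + (t₂₂ * ((s : ℝ) * (Real.sqrt 6 / 3))) ^ 2)))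 -
              layerInteraction lennardJones a h δ s)) →
    ∃ κ : ℝ, 0 < κ ∧ ∀ (G : EuclideanSpace ℝ (Fin 3) ≃L[ℝ] EuclideanSpace ℝ (Fin 3)),
        (∀ v : EuclideanSpace ℝ (Fin 3), 4 / 5 * ‖v‖ ≤ ‖G v‖ ∧ ‖G v‖ ≤ 6 / 5 * ‖v‖) →
        ∃ (A : EuclideanSpace ℝ (Fin 3) →ₗᵢ[ℝ] EuclideanSpace ℝ (Fin 3)) (a h : ℝ),
          47 / 50 ≤ a ∧ a ≤ 1 ∧ 39 / 50 * a ≤ h ∧ h ≤ 17 / 20 * a ∧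
          ∀ δ k i j : ℤ, ‖layerVec 1 (Real.sqrt 6 / 3) δ k i j‖ ≤ 3 →
            κ * (min (dist (G (layerVec 1 (Real.sqrt 6 / 3) δ k i j)) (A (layerVec a h δ k i j))) (1 / 10)) ^ 2 ≤
            (fun Δ : ℤ → ℤ → ℝ => (1 / 2 : ℝ) * (Δ 0 0 +
              (∑' k : ℕ, if k = 0 then min (Δ 1 1) (Δ (-1) 1)
                else min (Δ 0 ((k : ℤ) + 1)) (min (Δ 1 ((k : ℤ) + 1)) (Δ (-1) ((k : ℤ) + 1)))) +
              (∑' k : ℕ, if k = 0 then min (Δ 1 (-1)) (Δ (-1) (-1))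
                else min (Δ 0 (-((k : ℤ) + 1))) (min (Δ 1 (-((k : ℤ) + 1))) (Δ (-1) (-((k : ℤ) + 1)))))))
            (fun δ t => (∑' ij : ℤ × ℤ, lennardJones ‖G (layerVec 1 (Real.sqrt 6 / 3) δ t ij.1 ij.2)‖) -
              layerInteraction lennardJones a h δ t) := by
  rintro ⟨κ, hκ, hT⟩
  refine ⟨κ, hκ, ?_⟩
  intro G hG
  -- the Gram–Schmidt frame and the triangular coefficients
  set b := gramSchmidtOrthonormalBasis qr_finrank fun j => G (EuclideanSpace.single j (1 : ℝ)) with hb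
  set A := (EuclideanSpace.basisFun (Fin 3) ℝ).equiv b (Equiv.refl _) with hA
  set t : Fin 3 → Fin 3 → ℝ := fun l j => b.repr (G (EuclideanSpace.single j (1 : ℝ))) l with ht
  have hli := qr_linearIndependent G
  have h10 : t 1 0 = 0 := qr_upper _ (by decide)
  have h20 : t 2 0 = 0 := qr_upper _ (by decide)
  have h21 : t 2 1 = 0 := qr_upper _ (by decide)
  have h00 : 0 < t 0 0 := qr_diag_pos _ hli 0
  have h11 : 0 < t 1 1 := qr_diag_pos _ hli 1
  have h22 : 0 < t 2 2 := qr_diag_pos _ hli 2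
  -- coordinates and norms in the frame
  have hcoord : ∀ (v : EuclideanSpace ℝ (Fin 3)) (l : Fin 3), (A.symm (G v)) l = ∑ j : Fin 3, v j * t l j :=
    fun v l => qr_coord G v l
  have hnormsq : ∀ v : EuclideanSpace ℝ (Fin 3), ‖G v‖ ^ 2 =
      (t 0 0 * v 0 + t 0 1 * v 1 + t 0 2 * v 2) ^ 2 + (t 1 1 * v 1 + t 1 2 * v 2) ^ 2 + (t 2 2 * v 2) ^ 2 := by
    intro v
    rw [← A.symm.norm_map (G v), EuclideanSpace.norm_eq, Real.sq_sqrt (by positivity), Fin.sum_univ_three,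
      Real.norm_eq_abs, Real.norm_eq_abs, Real.norm_eq_abs, sq_abs, sq_abs, sq_abs, hcoord, hcoord, hcoord,
      Fin.sum_univ_three, Fin.sum_univ_three, Fin.sum_univ_three, h10, h20, h21]
    ring
  have hnorm : ∀ v : EuclideanSpace ℝ (Fin 3), ‖G v‖ =
      Real.sqrt ((t 0 0 * v 0 + t 0 1 * v 1 + t 0 2 * v 2) ^ 2 + (t 1 1 * v 1 + t 1 2 * v 2) ^ 2 + (t 2 2 * v 2) ^ 2) := by
    intro v
    rw [← hnormsq, Real.sqrt_sq (norm_nonneg _)]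
  -- the tube, polynomially
  have htube : ∀ x y z : ℝ, (4 / 5 : ℝ) ^ 2 * (x ^ 2 + y ^ 2 + z ^ 2) ≤
      (t 0 0 * x + t 0 1 * y + t 0 2 * z) ^ 2 + (t 1 1 * y + t 1 2 * z) ^ 2 + (t 2 2 * z) ^ 2 ∧
      (t 0 0 * x + t 0 1 * y + t 0 2 * z) ^ 2 + (t 1 1 * y + t 1 2 * z) ^ 2 + (t 2 2 * z) ^ 2 ≤
      (6 / 5 : ℝ) ^ 2 * (x ^ 2 + y ^ 2 + z ^ 2) := by
    intro x y z
    have hv : ‖(!₂[x, y, z] : EuclideanSpace ℝ (Fin 3))‖ ^ 2 = x ^ 2 + y ^ 2 + z ^ 2 := by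
      rw [EuclideanSpace.norm_eq, Real.sq_sqrt (by positivity), Fin.sum_univ_three]
      simp [Real.norm_eq_abs, sq_abs]
    obtain ⟨h1, h2⟩ := hG !₂[x, y, z]
    have h3 := hnormsq !₂[x, y, z]
    have e0 : (!₂[x, y, z] : EuclideanSpace ℝ (Fin 3)) 0 = x := by simp
    have e1 : (!₂[x, y, z] : EuclideanSpace ℝ (Fin 3)) 1 = y := by simp
    have e2 : (!₂[x, y, z] : EuclideanSpace ℝ (Fin 3)) 2 = z := by simp
    rw [e0, e1, e2] at h3
    have hn0 : 0 ≤ ‖(!₂[x, y, z] : EuclideanSpace ℝ (Fin 3))‖ := norm_nonneg _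
    have hg0 : 0 ≤ ‖G !₂[x, y, z]‖ := norm_nonneg _
    constructor
    · nlinarith [mul_self_le_mul_self (by positivity) h1]
    · nlinarith [mul_self_le_mul_self hg0 h2]
  -- apply the triangular-gauge inequality
  obtain ⟨a, h, ha1, ha2, hh1, hh2, hsite⟩ :=
    hT (t 0 0) (t 0 1) (t 0 2) (t 1 1) (t 1 2) (t 2 2) h00 h11 h22 htube
  refine ⟨A.toLinearIsometry, a, h, ha1, ha2, hh1, hh2, fun δ k i j hn => ?_⟩
  have key := hsite δ k i j hn
  -- the penalty: `dist (G p) (A q) = ‖T p − q‖`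
  have hpen : dist (G (layerVec 1 (Real.sqrt 6 / 3) δ k i j)) (A.toLinearIsometry (layerVec a h δ k i j)) =
      Real.sqrt (((t 0 0 - a) * ((i : ℝ) + (j : ℝ) / 2 + (δ : ℝ) / 2) + t 0 1 * (Real.sqrt 3 / 2 * ((j : ℝ) + (δ : ℝ) / 3)) + t 0 2 * ((k : ℝ) * (Real.sqrt 6 / 3))) ^ 2 + ((t 1 1 - a) * (Real.sqrt 3 / 2 * ((j : ℝ) + (δ : ℝ) / 3)) + t 1 2 * ((k : ℝ) * (Real.sqrt 6 / 3))) ^ 2 + ((t 2 2 - h / (Real.sqrt 6 / 3)) * ((k : ℝ) * (Real.sqrt 6 / 3))) ^ 2) := by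
    have e1 : dist (G (layerVec 1 (Real.sqrt 6 / 3) δ k i j)) (A.toLinearIsometry (layerVec a h δ k i j)) =
        ‖A.symm (G (layerVec 1 (Real.sqrt 6 / 3) δ k i j)) - layerVec a h δ k i j‖ := by
      rw [← A.symm.dist_map, dist_eq_norm]
      congr 1
      simp
    rw [e1, EuclideanSpace.norm_eq]
    congr 1
    rw [Fin.sum_univ_three, Real.norm_eq_abs, Real.norm_eq_abs, Real.norm_eq_abs, sq_abs, sq_abs, sq_abs]
    simp only [PiLp.sub_apply, hcoord, Fin.sum_univ_three, h10, h20, h21, layerVec_apply_zero, layerVec_apply_one,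
      layerVec_apply_two]
    have h6 : Real.sqrt 6 / 3 ≠ 0 := by positivity
    field_simp
    ring
  -- the word-free excess: `‖G v‖ = ‖T v‖` inside
  have hW : ∀ (δ s : ℤ) (ij : ℤ × ℤ), ‖G (layerVec 1 (Real.sqrt 6 / 3) δ s ij.1 ij.2)‖ =
      Real.sqrt ((t 0 0 * ((ij.1 : ℝ) + (ij.2 : ℝ) / 2 + (δ : ℝ) / 2) + t 0 1 * (Real.sqrt 3 / 2 * ((ij.2 : ℝ) + (δ : ℝ) / 3)) + t 0 2 * ((s : ℝ) * (Real.sqrt 6 / 3))) ^ 2 + (t 1 1 * (Real.sqrt 3 / 2 * ((ij.2 : ℝ) + (δ : ℝ) / 3)) + t 1 2 * ((s : ℝ) * (Real.sqrt 6 / 3))) ^ 2 + (t 2 2 * ((s : ℝ) * (Real.sqrt 6 / 3))) ^ 2) := by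
    intro δ s ij
    rw [hnorm]
    simp only [layerVec_apply_zero, layerVec_apply_one, layerVec_apply_two, one_mul]
  rw [hpen]
  simp only [hW]
  exact key


/-- **`LL⅒` from NEAR and FAR (stub piece `stub_layerLandscapeTenth_of_near_far`, proved)**: the registered numerics stub
`stub_layerLandscapeTenth` of skeleton v7 follows from the two interval-arithmetic claims `stub_triLandscapeNear`,
`stub_triLandscapeFar` (its two hypotheses, verbatim). [folklore] -/
theorem stub_layerLandscapeTenth_of_near_far :
    (∃ c : ℝ, 0 < c ∧ ∀ t₀₀ t₀₁ t₀₂ t₁₁ t₁₂ t₂₂ a h : ℝ, 0 < t₀₀ → 0 < t₁₁ → 0 < t₂₂ →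
        (∀ x y z : ℝ, (4 / 5 : ℝ) ^ 2 * (x ^ 2 + y ^ 2 + z ^ 2) ≤
          (t₀₀ * x + t₀₁ * y + t₀₂ * z) ^ 2 + (t₁₁ * y + t₁₂ * z) ^ 2 + (t₂₂ * z) ^ 2 ∧
        (t₀₀ * x + t₀₁ * y + t₀₂ * z) ^ 2 + (t₁₁ * y + t₁₂ * z) ^ 2 + (t₂₂ * z) ^ 2 ≤
          (6 / 5 : ℝ) ^ 2 * (x ^ 2 + y ^ 2 + z ^ 2)) →
        a = max (47 / 50) (min 1 ((t₀₀ + t₁₁) / 2)) →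
        h = max (39 / 50 * a) (min (17 / 20 * a) (Real.sqrt 6 / 3 * t₂₂)) →
        ((t₀₀ - a) ^ 2 + (t₁₁ - a) ^ 2 + (t₂₂ - h / (Real.sqrt 6 / 3)) ^ 2 + t₀₁ ^ 2 + t₀₂ ^ 2 + t₁₂ ^ 2) ≤ 1 / 100 →
        c * ((t₀₀ - a) ^ 2 + (t₁₁ - a) ^ 2 + (t₂₂ - h / (Real.sqrt 6 / 3)) ^ 2 + t₀₁ ^ 2 + t₀₂ ^ 2 + t₁₂ ^ 2) ≤
        (fun Δ : ℤ → ℤ → ℝ => (1 / 2 : ℝ) * (Δ 0 0 +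
            (∑' k : ℕ, if k = 0 then min (Δ 1 1) (Δ (-1) 1)
              else min (Δ 0 ((k : ℤ) + 1)) (min (Δ 1 ((k : ℤ) + 1)) (Δ (-1) ((k : ℤ) + 1)))) +
            (∑' k : ℕ, if k = 0 then min (Δ 1 (-1)) (Δ (-1) (-1))
              else min (Δ 0 (-((k : ℤ) + 1))) (min (Δ 1 (-((k : ℤ) + 1))) (Δ (-1) (-((k : ℤ) + 1)))))))
          (fun δ s => (∑' ij : ℤ × ℤ, lennardJones (Real.sqrt ((t₀₀ * ((ij.1 : ℝ) + (ij.2 : ℝ) / 2 + (δ : ℝ) / 2) + t₀₁ * (Real.sqrt 3 / 2 * ((ij.2 : ℝ) + (δ : ℝ) / 3)) + t₀₂ * ((s : ℝ) * (Real.sqrt 6 / 3))) ^ 2 + (t₁₁ * (Real.sqrt 3 / 2 * ((ij.2 : ℝ) + (δ : ℝ) / 3)) + t₁₂ * ((s : ℝ) * (Real.sqrt 6 / 3))) ^ 2 + (t₂₂ * ((s : ℝ) * (Real.sqrt 6 / 3))) ^ 2))) -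
            layerInteraction lennardJones a h δ s)) →
    (∃ w₀ : ℝ, 0 < w₀ ∧ ∀ t₀₀ t₀₁ t₀₂ t₁₁ t₁₂ t₂₂ a h : ℝ, 0 < t₀₀ → 0 < t₁₁ → 0 < t₂₂ →
        (∀ x y z : ℝ, (4 / 5 : ℝ) ^ 2 * (x ^ 2 + y ^ 2 + z ^ 2) ≤
          (t₀₀ * x + t₀₁ * y + t₀₂ * z) ^ 2 + (t₁₁ * y + t₁₂ * z) ^ 2 + (t₂₂ * z) ^ 2 ∧
        (t₀₀ * x + t₀₁ * y + t₀₂ * z) ^ 2 + (t₁₁ * y + t₁₂ * z) ^ 2 + (t₂₂ * z) ^ 2 ≤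
          (6 / 5 : ℝ) ^ 2 * (x ^ 2 + y ^ 2 + z ^ 2)) →
        a = max (47 / 50) (min 1 ((t₀₀ + t₁₁) / 2)) →
        h = max (39 / 50 * a) (min (17 / 20 * a) (Real.sqrt 6 / 3 * t₂₂)) →
        1 / 100 ≤ ((t₀₀ - a) ^ 2 + (t₁₁ - a) ^ 2 + (t₂₂ - h / (Real.sqrt 6 / 3)) ^ 2 + t₀₁ ^ 2 + t₀₂ ^ 2 + t₁₂ ^ 2) →
        w₀ ≤
        (fun Δ : ℤ → ℤ → ℝ => (1 / 2 : ℝ) * (Δ 0 0 +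
            (∑' k : ℕ, if k = 0 then min (Δ 1 1) (Δ (-1) 1)
              else min (Δ 0 ((k : ℤ) + 1)) (min (Δ 1 ((k : ℤ) + 1)) (Δ (-1) ((k : ℤ) + 1)))) +
            (∑' k : ℕ, if k = 0 then min (Δ 1 (-1)) (Δ (-1) (-1))
              else min (Δ 0 (-((k : ℤ) + 1))) (min (Δ 1 (-((k : ℤ) + 1))) (Δ (-1) (-((k : ℤ) + 1)))))))
          (fun δ s => (∑' ij : ℤ × ℤ, lennardJones (Real.sqrt ((t₀₀ * ((ij.1 : ℝ) + (ij.2 : ℝ) / 2 + (δ : ℝ) / 2) + t₀₁ * (Real.sqrt 3 / 2 * ((ij.2 : ℝ) + (δ : ℝ) / 3)) + t₀₂ * ((s : ℝ) * (Real.sqrt 6 / 3))) ^ 2 + (t₁₁ * (Real.sqrt 3 / 2 * ((ij.2 : ℝ) + (δ : ℝ) / 3)) + t₁₂ * ((s : ℝ) * (Real.sqrt 6 / 3))) ^ 2 + (t₂₂ * ((s : ℝ) * (Real.sqrt 6 / 3))) ^ 2))) -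
            layerInteraction lennardJones a h δ s)) →
    ∃ κ : ℝ, 0 < κ ∧ ∀ (G : EuclideanSpace ℝ (Fin 3) ≃L[ℝ] EuclideanSpace ℝ (Fin 3)),
        (∀ v : EuclideanSpace ℝ (Fin 3), 4 / 5 * ‖v‖ ≤ ‖G v‖ ∧ ‖G v‖ ≤ 6 / 5 * ‖v‖) →
        ∃ (A : EuclideanSpace ℝ (Fin 3) →ₗᵢ[ℝ] EuclideanSpace ℝ (Fin 3)) (a h : ℝ),
          47 / 50 ≤ a ∧ a ≤ 1 ∧ 39 / 50 * a ≤ h ∧ h ≤ 17 / 20 * a ∧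
          ∀ δ k i j : ℤ, ‖layerVec 1 (Real.sqrt 6 / 3) δ k i j‖ ≤ 3 →
            κ * (min (dist (G (layerVec 1 (Real.sqrt 6 / 3) δ k i j)) (A (layerVec a h δ k i j))) (1 / 10)) ^ 2 ≤
            (fun Δ : ℤ → ℤ → ℝ => (1 / 2 : ℝ) * (Δ 0 0 +
              (∑' k : ℕ, if k = 0 then min (Δ 1 1) (Δ (-1) 1)
                else min (Δ 0 ((k : ℤ) + 1)) (min (Δ 1 ((k : ℤ) + 1)) (Δ (-1) ((k : ℤ) + 1)))) +
              (∑' k : ℕ, if k = 0 then min (Δ 1 (-1)) (Δ (-1) (-1))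
                else min (Δ 0 (-((k : ℤ) + 1))) (min (Δ 1 (-((k : ℤ) + 1))) (Δ (-1) (-((k : ℤ) + 1)))))))
            (fun δ t => (∑' ij : ℤ × ℤ, lennardJones ‖G (layerVec 1 (Real.sqrt 6 / 3) δ t ij.1 ij.2)‖) -
              layerInteraction lennardJones a h δ t) :=
  fun hN hF => stub_layerLandscapeTenth_of_tri (stub_triLandscapeTenth_of_near_far hN hF)

end Summit.AtomisticToContinuum.Crystallization.Theorems.NashClassCertificatesNashNearField

end
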